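import Literature.MathematicalPhysics.QuantumFieldTheory.Balaban1983to89.B1Eq324BenfattoClassSectEMemberPrecisionDoorRecordV4P
import Literature.MathematicalPhysics.QuantumFieldTheory.Balaban1983to89.B9PinMemberPivotExact

/-!
# `Balaban1983to89.B1Eq324BenfattoClassSectEMemberPrecisionDoorRecordV4PPivotLines` — THE (3.24) STAR DOORS OF RECORD AT NODE 00's v4P LETTERS WITH
# NODE 00's LAST REGIME ROW CONFINED TO THE PIVOT LINES OF BAD-SOURCE STAR CORNERS (seat dag-n08-d g41, INTENT-101, over seat n08-b's `B9PinMemberPivotExact`;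
# node N08 [Balaban1985UV3], row `h324c`)

statement-level companion of published sources with citation tags; every declaration here is a theorem; nothing here is a claim about the
Yang–Mills mass gap

T. Bałaban, *Propagators for lattice gauge theories in a background field*, Commun. Math. Phys. **99** (1985) 389–434 [Balaban1985BackgroundPropagators] (= [B9]):
Sect. E (3.155)–(3.158) pp. 427–428 — p. 428: *«(CB̃)(b₀) is equal to a solution of the equation (QB)(c) = 0, considered as an equation on the variable B(b₀)»* (the
pivot coefficient `K_c(V)` of (3.157)); (3.35) p. 396; *Averaging operations for lattice gauge theories*, CMP **98** (1985) 17–51 [Balaban1985Averaging] (= [5]),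
(14) p. 19, (125)–(126) p. 36 (the transport combs); *Propagators and renormalization transformations II*, CMP **96** (1984) 223–250 [Balaban1984PropagatorsII]
(= [4]), (2.3) p. 224, Lemma 2.4 p. 245; *Ultraviolet stability of three-dimensional lattice pure gauge field theories*, CMP **102** (1985) 255–275 [Balaban1985UV3],
(24) p. 262; [Balaban1982Higgs1] CMP **85** (1982), (3.24) p. 616; [BenfattoEtAl1978] CMP **59** (1978), Lemma (4.5)–(4.7) p. 152.

WHY THIS MODULE (cell `pub-ymgap`, seat `dag-n08-d` gen 41, INTENT-101 = seat n08-b g39's ■ trigger (t2) «bad-source door edition with `hV` confined to pivot lines over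
n08-d's v4P door»).  Seat n08-b's `B9PinMemberPivotExact` (p707580) proved that at every star corner whose SOURCE block is good the pivot coefficient of (3.157) is
the exact conjugation `K_c(V) = L^{−(d+1)}·Ad V([c₋, b₀(c)₋])` — a unit at EVERY background, `‖K_c(V)⁻¹a‖ ≤ L^{d+1}‖a‖` — and that at the star corners with a
BAD source block (node00-def-Y RULING-25 (ii): «dictionary deviation of NODE 00: transport comb empty off Λ′») `K_c(V)` is the average of the `L` partial-line
conjugations, a unit once `V` is `δ`-small on the `L − 1` unit bonds of the pivot line with `(L−1)·2δ < 1` (`isUnit_K[T]stY_of_small_on_line`).  The v4P star doors of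
record (`…PrecisionDoorRecordV4P` §4, p708018) display NODE 00's three star-pivot rows `hK ∕ hKT ∕ hKinv`, discharged there by the small averaged field on ALL unit
bonds.  This file confines that regime row to where the dictionary needs it:
* §1 (generic fibre `𝔸`, averaged-field letter `𝔳`, contraction group `G`) ★ `norm_smul_KstY_sub_le_of_small_on_line` — the deviation estimate
  `‖(L^{d+1}·K_c(V))a − a‖ ≤ ℓ·2δ·‖a‖` at a bad-source star corner under smallness on its pivot line (seat n08-b's estimate, inline in `isUnit_KstY_of_small_on_line`,
  here a named row); ★★ `norm_inverse_KstY_apply_le_of_small_on_line` — the bad-source PIVOT-INVERSE row `‖K_c(V)⁻¹a‖ ≤ (1 − ℓ·2δ)⁻¹·L^{d+1}·‖a‖` (seat n08-d's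
  Neumann lemma `…ERowsAtNode00.norm_inverse_apply_le_of_norm_smul_sub_le`); ★★ the ALL-CORNER rows under «`V` `δ`-small on the pivot lines of the bad-source
  star corners ONLY» — `isUnit_KstY_of_pivotLines`, `isUnit_KTstY_of_pivotLines`, `norm_inverse_KstY_apply_le_of_pivotLines` (good source: p707580's exact rows
  and `1 ≤ (1 − κ)⁻¹`; bad source: §1) — and the record bundle `star_pivot_rows_avYOfRecord_of_pivotLines` (`M_N(ℂ)`, `V = avYOfRecord x U`, `G ≤ U(N)`).
* §2 ★★★ the star doors of record at the v4P letters with `hK ∕ hKT ∕ hKinv` DISCHARGED under that confined regime: `…_of_pivotLines_onΛst_on_unit` (p708018 §4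
  `_of_units` + §1), `…_of_ineq3132_of_pivotLines_…` (P-row by name at `opsYNuStOfRecordV4PE`), `…_of_stmt3132Printed_P_of_pivotLines_…` (family at print's class
  `bg9YP`), ★★★★ `…_of_b9LeafX_of_pivotLines_onΛst_on_unit` (MODULO node N06's socket of record `B9LeafX (Y9OfRecordP N θ M⋆ (opsYNuStOfRecordV4PE …))`).
  Displayed regime per background: `G ≤ U(N)`, `G`-valued `U`, and `‖V⟨c₋ + i·e_μ, μ⟩ − 1‖ ≤ δ_V` for `i < ℓ` at the star corners `c = (c₋, μ)` with a bad source
  block, `ℓ·2δ_V < 1` — NOTHING at good-source corners (print p. 428 asks no smallness for `C`), and the bad-corner row is NODE 00's dictionary deviation, idle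
  under node00-def-Y's booked transport-comb edition «V-TR» (RULING-25 (iii)); the rows are keyed to p707580's `KstY_eq_sum_of_not_goodY` (itself keyed to
  `uΓ_of_not_good`) so that edition supersedes them by one rewrite.

HONEST SCOPE.  Count-neutral finite estimates + compositions BY NAME over def-Y's letters and seat n08-b's kernel algebra; no estimate of [B9] ∕ [4] ∕ [5] ∕
[BenfattoEtAl1978] ∕ [Balaban1985UV3] is asserted beyond what the tree proves; [5]'s reality rows, the 𝒥-row on STAR pairs and the Δ_k-row `γ₀` (G-B9-09) stay
displayed; the IDENT for row `h324c` is NOT made; node N06 ∕ N08 NOT discharged; one finite 𝕋^{d+1} programme — nothing about d = 4 specifically, the continuum, OS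
axioms, a mass gap or the Clay problem.  No `sorry`, no `def`, no `instance`, no `notation`.
-/

noncomputable section

open MeasureTheory Finset Matrix
open scoped Matrix.Norms.L2Operator

namespace Literature.MathematicalPhysics.QuantumFieldTheory.Balaban1983to89.B1Eq324BenfattoClassSectEMemberPrecisionDoorRecordV4PPivotLines

open Literature.MathematicalPhysics.QuantumFieldTheory
open Literature.MathematicalPhysics.QuantumFieldTheory.Balaban1983to89.B1Eq324BenfattoLemma
open Literature.MathematicalPhysics.QuantumFieldTheory.Balaban1983to89.Node00
open Literature.MathematicalPhysics.QuantumFieldTheory.Balaban1983to89.DagBinding (B9LeafX)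
open B9Eq3169Mu (hol)
open B9Eq39Adjoint (R)
open B6BondElimination (unitVec)
open B9PinMembersKLevelV1 (MemberY geo9Y bg9Y)
open B9BackgroundsKLevelV1P (bg9YP)
open B9PinCarriersKLevelV1P (siteKernelP)
open B9PinGeometryKLevelV1 (unitDistY)
open B9Thm311ReadingCoords (trIP IsSymmTr)
open B9CoReadingCoordsTranspose (trReForm TrIdx trBasis)
open B7Prop2Explicit (unitaryUnits)
open B7Prop2SpecialUnitary (specialUnitaryUnits specialUnitaryUnits_le_unitaryUnits)
open B1Eq324BenfattoClassSectEMemberERowsAtNode00 (norm_inverse_apply_le_of_norm_smul_sub_le)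
open B9PinMemberPivotExact (KstY_eq_sum_of_not_goodY norm_hol_sub_self_le_of_forall_mem norm_RUY_le isUnit_KstY_of_goodY isUnit_KTstY_of_goodY
  norm_inverse_KstY_apply_le_of_goodY isUnit_KstY_of_small_on_line isUnit_KTstY_of_small_on_line)
open B1Eq324BenfattoClassSectEMemberPrecisionDoorRecordV4P (pRowOnΛst_opsYNuStOfRecordV4PE_of_ineq3132
  eq324_CsDeltaCPstY_lettersYOfRecordV4P_sectEStYOfRecordV7_trBasis_of_units_onΛst_on_unit)

/-! ## §1  The pivot rows under smallness on the PIVOT LINES of the bad-source star corners only -/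

section PivotLines

variable {d ℓ : ℕ} {hd : 1 ≤ d + 1} {hL : Odd (ℓ + 1) ∧ 1 < ℓ + 1} {b₀ b₁ : ℝ} {Mstar : ℕ}
variable {𝔸 : Type} [NormedRing 𝔸] [NormedAlgebra ℂ 𝔸] [CompleteSpace 𝔸]
variable (x : MemberY d ℓ hd hL b₀ b₁ Mstar) (𝔳 : AvY 𝔸 x) {G : Subgroup 𝔸ˣ}

/-- ★ **BAD SOURCE BLOCK: the deviation of `L^{d+1}·K_c(V)` from the identity under smallness on the pivot line** — `‖(L^{d+1}·K_c(V))a − a‖ ≤ ℓ·(2δ)·‖a‖` when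
`‖V(b) − 1‖ ≤ δ` on the `L − 1` unit bonds `[c₋, b₀(c)₋]` and `V` is contraction-valued (seat n08-b's estimate inside `B9PinMemberPivotExact.isUnit_KstY_of_small_on_line`,
exported as a row: `K_c(V)a = L^{−(d+2)}Σ_{s<L} Ad V(partial line_s) a` by `KstY_eq_sum_of_not_goodY`, each conjugation along `≤ ℓ` bonds moves `a` by `≤ ℓ·2δ‖a‖`).
[cite: Balaban1985BackgroundPropagators, (3.157) p.428, (3.35) p.397; Balaban1985Averaging, (125)–(126) p.36, (14) p.19] -/
theorem norm_smul_KstY_sub_le_of_small_on_line (hG1 : ∀ g ∈ G, ‖((g : 𝔸ˣ) : 𝔸)‖ ≤ 1) {U : CfgY 𝔸 x.toKIdx} (h𝔳 : ∀ b, 𝔳 U b ∈ G) (c : CBondStY x)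
    (hg : ¬ GoodY x c.1.1) {δ : ℝ} (hδ0 : 0 ≤ δ) (hδ : ∀ i : ℕ, i < ℓ → ‖((𝔳 U ⟨ofZ x (labK x c.1.1 + (i : ℤ) • unitVec c.1.2), c.1.2⟩ : 𝔸ˣ) : 𝔸) - 1‖ ≤ δ)
    (a : 𝔸) : ‖((((ℓ + 1 : ℕ) : ℂ)) ^ (d + 1) • KstY x 𝔳 U c) a - a‖ ≤ (ℓ : ℝ) * (2 * δ) * ‖a‖ := by
  have hLne : (((ℓ + 1 : ℕ) : ℂ)) ^ (d + 1) ≠ 0 := pow_ne_zero _ (Nat.cast_ne_zero.2 (Nat.succ_ne_zero ℓ))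
  have hL1 : (((ℓ + 1 : ℕ) : ℂ)) ≠ 0 := Nat.cast_ne_zero.2 (Nat.succ_ne_zero ℓ)
  rw [LinearMap.smul_apply, KstY_eq_sum_of_not_goodY x 𝔳 U c hg a, smul_smul]
  have hq : (((ℓ + 1 : ℕ) : ℂ)) ^ (d + 1) * qNormY d ℓ = ((((ℓ + 1 : ℕ) : ℂ)))⁻¹ := by
    rw [qNormY, show (((ℓ + 1 : ℕ) : ℂ)) ^ (d + 2) = (((ℓ + 1 : ℕ) : ℂ)) ^ (d + 1) * (((ℓ + 1 : ℕ) : ℂ)) from pow_succ _ _, mul_inv, ← mul_assoc,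
      mul_inv_cancel₀ hLne, one_mul]
  rw [hq]
  set F : ℕ → 𝔸 := fun s => hol (RUY x 𝔳 U) ((List.range s).map fun i : ℕ =>
    (⟨ofZ x (labK x c.1.1 + ((ℓ - s + i : ℕ) : ℤ) • unitVec c.1.2), c.1.2⟩ : UBondY x)) a with hF
  have e : ((((ℓ + 1 : ℕ) : ℂ)))⁻¹ • (∑ s ∈ Finset.range (ℓ + 1), F s) - a = ((((ℓ + 1 : ℕ) : ℂ)))⁻¹ • ∑ s ∈ Finset.range (ℓ + 1), (F s - a) := by
    rw [Finset.sum_sub_distrib, smul_sub, Finset.sum_const, Finset.card_range, ← Nat.cast_smul_eq_nsmul ℂ, smul_smul, inv_mul_cancel₀ hL1, one_smul]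
  rw [e, norm_smul, norm_inv, Complex.norm_natCast]
  have hterm : ∀ s ∈ Finset.range (ℓ + 1), ‖F s - a‖ ≤ (ℓ : ℝ) * (2 * δ) * ‖a‖ := by
    intro s hs
    rw [Finset.mem_range] at hs
    have h1 := norm_hol_sub_self_le_of_forall_mem (RUY x 𝔳 U) (norm_RUY_le x 𝔳 hG1 h𝔳) (δ := 2 * δ)
      ((List.range s).map fun i : ℕ => (⟨ofZ x (labK x c.1.1 + ((ℓ - s + i : ℕ) : ℤ) • unitVec c.1.2), c.1.2⟩ : UBondY x)) ?_ a
    · rw [List.length_map, List.length_range] at h1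
      refine h1.trans ?_
      have hsℓ : (s : ℝ) ≤ ℓ := by exact_mod_cast (by omega : s ≤ ℓ)
      have := norm_nonneg a
      gcongr
    · intro b hb v
      rw [List.mem_map] at hb
      obtain ⟨i, hi, rfl⟩ := hb
      rw [List.mem_range] at hi
      rw [RUY_apply]
      exact norm_R_sub_self_le_of_le (hG1 _ (G.inv_mem (h𝔳 _))) (hδ (ℓ - s + i) (by omega)) v
  refine (mul_le_mul_of_nonneg_left ((norm_sum_le _ _).trans (Finset.sum_le_card_nsmul _ _ _ hterm)) (by positivity)).trans ?_
  rw [Finset.card_range, nsmul_eq_mul, ← mul_assoc, inv_mul_cancel₀ (Nat.cast_ne_zero.2 (Nat.succ_ne_zero ℓ)), one_mul]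

/-- ★★ **BAD SOURCE BLOCK: THE PIVOT-INVERSE ROW UNDER SMALLNESS ON THE PIVOT LINE** — `‖K_c(V)⁻¹a‖ ≤ (1 − ℓ·2δ)⁻¹·L^{d+1}·‖a‖` (the unit is seat n08-b's
`isUnit_KstY_of_small_on_line`; the bound is seat n08-d's Neumann lemma `norm_inverse_apply_le_of_norm_smul_sub_le` on §1's deviation estimate).  The row p707580 §3
does not carry; with it the bad-source star corners feed the door's `hKinv`. [cite: Balaban1985BackgroundPropagators, (3.157) p.428, (3.35) p.397; Balaban1985Averaging, (126) p.36] -/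
theorem norm_inverse_KstY_apply_le_of_small_on_line (hG1 : ∀ g ∈ G, ‖((g : 𝔸ˣ) : 𝔸)‖ ≤ 1) {U : CfgY 𝔸 x.toKIdx} (h𝔳 : ∀ b, 𝔳 U b ∈ G) (c : CBondStY x)
    (hg : ¬ GoodY x c.1.1) {δ : ℝ} (hδ0 : 0 ≤ δ) (hδ : ∀ i : ℕ, i < ℓ → ‖((𝔳 U ⟨ofZ x (labK x c.1.1 + (i : ℤ) • unitVec c.1.2), c.1.2⟩ : 𝔸ˣ) : 𝔸) - 1‖ ≤ δ)
    (hsmall : (ℓ : ℝ) * (2 * δ) < 1) (a : 𝔸) :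
    ‖Ring.inverse (KstY x 𝔳 U c) a‖ ≤ (1 - (ℓ : ℝ) * (2 * δ))⁻¹ * (((ℓ + 1 : ℕ) : ℝ)) ^ (d + 1) * ‖a‖ := by
  have hLpn : ‖(((ℓ + 1 : ℕ) : ℂ)) ^ (d + 1)‖ = (((ℓ + 1 : ℕ) : ℝ)) ^ (d + 1) := by rw [norm_pow, Complex.norm_natCast]
  have h := norm_inverse_apply_le_of_norm_smul_sub_le (KstY x 𝔳 U c) (isUnit_KstY_of_small_on_line x 𝔳 hG1 h𝔳 c hδ0 hδ hsmall) hsmall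
    (norm_smul_KstY_sub_le_of_small_on_line x 𝔳 hG1 h𝔳 c hg hδ0 hδ) a
  rw [hLpn, div_eq_mul_inv, mul_comm ((((ℓ + 1 : ℕ) : ℝ)) ^ (d + 1))] at h
  exact h

/-- ★★ **ALL STAR CORNERS: `K_c(V)` IS A UNIT when `V` is `δ`-small on the pivot lines of the BAD-source star corners only** (`ℓ·2δ < 1`; good source: p707580's
`isUnit_KstY_of_goodY`, no hypothesis; bad source: `isUnit_KstY_of_small_on_line`). [cite: Balaban1985BackgroundPropagators, (3.157) p.428, (3.35) p.397; Balaban1985Averaging, (125)–(126) p.36] -/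
theorem isUnit_KstY_of_pivotLines (hG1 : ∀ g ∈ G, ‖((g : 𝔸ˣ) : 𝔸)‖ ≤ 1) {U : CfgY 𝔸 x.toKIdx} (h𝔳 : ∀ b, 𝔳 U b ∈ G) {δ : ℝ} (hδ0 : 0 ≤ δ)
    (hδ : ∀ c : CBondStY x, ¬ GoodY x c.1.1 → ∀ i : ℕ, i < ℓ → ‖((𝔳 U ⟨ofZ x (labK x c.1.1 + (i : ℤ) • unitVec c.1.2), c.1.2⟩ : 𝔸ˣ) : 𝔸) - 1‖ ≤ δ)
    (hsmall : (ℓ : ℝ) * (2 * δ) < 1) (c : CBondStY x) : IsUnit (KstY x 𝔳 U c) := by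
  by_cases hg : GoodY x c.1.1
  · exact isUnit_KstY_of_goodY x 𝔳 U c hg
  · exact isUnit_KstY_of_small_on_line x 𝔳 hG1 h𝔳 c hδ0 (hδ c hg) hsmall

/-- ★★ **ALL STAR CORNERS: `K_c(V)*` IS A UNIT** under the same confined regime. [cite: Balaban1985BackgroundPropagators, (3.157) p.428, (3.9) p.391, (3.35) p.397; Balaban1985Averaging, (126) p.36] -/
theorem isUnit_KTstY_of_pivotLines (hG1 : ∀ g ∈ G, ‖((g : 𝔸ˣ) : 𝔸)‖ ≤ 1) {U : CfgY 𝔸 x.toKIdx} (h𝔳 : ∀ b, 𝔳 U b ∈ G) {δ : ℝ} (hδ0 : 0 ≤ δ)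
    (hδ : ∀ c : CBondStY x, ¬ GoodY x c.1.1 → ∀ i : ℕ, i < ℓ → ‖((𝔳 U ⟨ofZ x (labK x c.1.1 + (i : ℤ) • unitVec c.1.2), c.1.2⟩ : 𝔸ˣ) : 𝔸) - 1‖ ≤ δ)
    (hsmall : (ℓ : ℝ) * (2 * δ) < 1) (c : CBondStY x) : IsUnit (KTstY x 𝔳 U c) := by
  by_cases hg : GoodY x c.1.1
  · exact isUnit_KTstY_of_goodY x 𝔳 U c hg
  · exact isUnit_KTstY_of_small_on_line x 𝔳 hG1 h𝔳 c hδ0 (hδ c hg) hsmall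

/-- ★★ **ALL STAR CORNERS: THE PIVOT-INVERSE ROW `‖K_c(V)⁻¹a‖ ≤ (1 − ℓ·2δ)⁻¹·L^{d+1}·‖a‖`** under the confined regime (good source: p707580's sharp `L^{d+1}‖a‖` and
`1 ≤ (1 − ℓ·2δ)⁻¹`; bad source: §1). [cite: Balaban1985BackgroundPropagators, (3.157) p.428, (3.35) p.397; Balaban1985Averaging, (125)–(126) p.36] -/
theorem norm_inverse_KstY_apply_le_of_pivotLines (hG1 : ∀ g ∈ G, ‖((g : 𝔸ˣ) : 𝔸)‖ ≤ 1) {U : CfgY 𝔸 x.toKIdx} (h𝔳 : ∀ b, 𝔳 U b ∈ G) {δ : ℝ} (hδ0 : 0 ≤ δ)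
    (hδ : ∀ c : CBondStY x, ¬ GoodY x c.1.1 → ∀ i : ℕ, i < ℓ → ‖((𝔳 U ⟨ofZ x (labK x c.1.1 + (i : ℤ) • unitVec c.1.2), c.1.2⟩ : 𝔸ˣ) : 𝔸) - 1‖ ≤ δ)
    (hsmall : (ℓ : ℝ) * (2 * δ) < 1) (c : CBondStY x) (a : 𝔸) :
    ‖Ring.inverse (KstY x 𝔳 U c) a‖ ≤ (1 - (ℓ : ℝ) * (2 * δ))⁻¹ * (((ℓ + 1 : ℕ) : ℝ)) ^ (d + 1) * ‖a‖ := by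
  by_cases hg : GoodY x c.1.1
  · refine (norm_inverse_KstY_apply_le_of_goodY x 𝔳 hG1 h𝔳 c hg a).trans ?_
    have hκ0 : 0 ≤ (ℓ : ℝ) * (2 * δ) := by positivity
    have h1 : (1 : ℝ) ≤ (1 - (ℓ : ℝ) * (2 * δ))⁻¹ := one_le_inv_iff₀.2 ⟨by linarith, by linarith⟩
    have hpos : (0 : ℝ) ≤ (((ℓ + 1 : ℕ) : ℝ)) ^ (d + 1) * ‖a‖ := by positivity
    calc (((ℓ + 1 : ℕ) : ℝ)) ^ (d + 1) * ‖a‖ = 1 * ((((ℓ + 1 : ℕ) : ℝ)) ^ (d + 1) * ‖a‖) := (one_mul _).symm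
      _ ≤ (1 - (ℓ : ℝ) * (2 * δ))⁻¹ * ((((ℓ + 1 : ℕ) : ℝ)) ^ (d + 1) * ‖a‖) := mul_le_mul_of_nonneg_right h1 hpos
      _ = (1 - (ℓ : ℝ) * (2 * δ))⁻¹ * (((ℓ + 1 : ℕ) : ℝ)) ^ (d + 1) * ‖a‖ := (mul_assoc _ _ _).symm
  · exact norm_inverse_KstY_apply_le_of_small_on_line x 𝔳 hG1 h𝔳 c hg hδ0 (hδ c hg) hsmall a

end PivotLines

section Record

variable (N : ℕ) (θ : Stage3Params) (Mstar : ℕ)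

/-- ★★ **THE THREE STAR-PIVOT ROWS OF THE DOOR OF RECORD (`hK ∕ hKT ∕ hKinv`) AT THE RECORD** (`M_N(ℂ)`, `V = avYOfRecord x U`, `G ≤ U(N)`, `G`-valued `U`) under
«`V` `δ_V`-small on the pivot lines of the bad-source star corners, `ℓ·2δ_V < 1`» — with `κ_K := (1 − ℓ·2δ_V)⁻¹` (`hG1` by the C⋆-identity, `G`-valuedness of `V` by
`avYOfRecord_mem`). [cite: Balaban1985BackgroundPropagators, (3.157) p.428, (3.40) p.397, (3.35) p.397; Balaban1984PropagatorsII, Lemma 2.4 p.245] -/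
theorem star_pivot_rows_avYOfRecord_of_pivotLines (x : MemberY θ.d₆ θ.ℓ₆ θ.hd' θ.hL' θ.b₀ θ.b₁ Mstar) {G : Subgroup (Matrix (Fin N) (Fin N) ℂ)ˣ}
    (hG : G ≤ unitaryUnits (Matrix (Fin N) (Fin N) ℂ)) {U : CfgY (Matrix (Fin N) (Fin N) ℂ) x.toKIdx} (hU : ∀ μ z, U μ z ∈ G) {δV : ℝ} (hδV : 0 ≤ δV)
    (hV : ∀ c' : CBondStY x, ¬ GoodY x c'.1.1 → ∀ i : ℕ, i < θ.ℓ₆ →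
      ‖((avYOfRecord x U ⟨ofZ x (labK x c'.1.1 + (i : ℤ) • unitVec c'.1.2), c'.1.2⟩ : (Matrix (Fin N) (Fin N) ℂ)ˣ) : Matrix (Fin N) (Fin N) ℂ) - 1‖ ≤ δV)
    (hsmall : (θ.ℓ₆ : ℝ) * (2 * δV) < 1) :
    (∀ c' : CBondStY x, IsUnit (KstY x (avYOfRecord x) U c')) ∧ (∀ c' : CBondStY x, IsUnit (KTstY x (avYOfRecord x) U c')) ∧
      ∀ (c' : CBondStY x) (a : Matrix (Fin N) (Fin N) ℂ),
        ‖Ring.inverse (KstY x (avYOfRecord x) U c') a‖ ≤ (1 - (θ.ℓ₆ : ℝ) * (2 * δV))⁻¹ * (((θ.ℓ₆ + 1 : ℕ) : ℝ)) ^ (θ.d₆ + 1) * ‖a‖ :=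
  ⟨fun c' => isUnit_KstY_of_pivotLines x _ (norm_coe_le_one_of_le_unitaryUnits hG) (fun b => avYOfRecord_mem x hU b) hδV hV hsmall c',
    fun c' => isUnit_KTstY_of_pivotLines x _ (norm_coe_le_one_of_le_unitaryUnits hG) (fun b => avYOfRecord_mem x hU b) hδV hV hsmall c',
    fun c' a => norm_inverse_KstY_apply_le_of_pivotLines x _ (norm_coe_le_one_of_le_unitaryUnits hG) (fun b => avYOfRecord_mem x hU b) hδV hV hsmall c' a⟩

end Record

/-! ## §2  The star doors of record at the v4P letters, NODE 00's last regime row confined to the pivot lines of the bad-source star corners -/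

section Doors

/-- ★★★ **THE (3.24) STAR DOOR OF RECORD AT THE v4P LETTERS — NODE 00's PIVOT ROWS DISCHARGED WITH NO HYPOTHESIS AT GOOD-SOURCE STAR CORNERS AND SMALLNESS OF THE
AVERAGED FIELD ON THE PIVOT LINES OF THE BAD-SOURCE ONES** — `…PrecisionDoorRecordV4P.eq324_CsDeltaCPstY_lettersYOfRecordV4P_sectEStYOfRecordV7_trBasis_of_units_onΛst_on_unit`
(p708018 §4) with `hK ∕ hKT ∕ hKinv` := §1's `star_pivot_rows_avYOfRecord_of_pivotLines` (`κ_K := (1 − ℓ·2δ_V)⁻¹`).  Displayed per background: `G ≤ U(N)`, `G`-valued `U`,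
`‖V⟨c₋ + i·e_μ, μ⟩ − 1‖ ≤ δ_V` (`i < ℓ`) at every star corner `c = (c₋, μ)` whose source block is NOT good (NODE 00's dictionary deviation, RULING-25 (ii)), [5]'s reality
`IsSymmTr ((𝔯 x).Δ2 U) ∕ ((𝔢₀ x).D2J U)`, the (3.132) P-row for `(lettersYOfRecordV4P …).QG1Qinv U` and the 𝒥-row on STAR pairs, the Δ_k-row `γ₀`.  Conclusion: (3.24) for
`𝒩(0, 𝕄_ι(CsDeltaCPstY x (lettersYOfRecordV4P N θ M⋆ 𝔯 x) (sectEStYOfRecordV7 N θ M⋆ 𝔢₀ x) U)⁻¹)`.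
[cite: Balaban1985BackgroundPropagators, (3.35) p.396, (3.132) p.422, (3.155)–(3.158) pp.427–428, Thm 3.11 p.416; Balaban1985Averaging, (14) p.19, (125)–(126) p.36;
Balaban1984PropagatorsII, (2.3) p.224, Lemma 2.4 p.245, (2.153)–(2.156) pp.249–250; Balaban1985UV3, (24) p.262, pp.271–272; Balaban1982Higgs1, (3.24) p.616;
BenfattoEtAl1978, Lemma (4.5)–(4.7) p.152 (class form; bent window, presentation and coordinates ours)] -/
theorem eq324_CsDeltaCPstY_lettersYOfRecordV4P_sectEStYOfRecordV7_trBasis_of_pivotLines_onΛst_on_unit (N : ℕ) [NeZero N] (θ : Stage3Params) (Mstar : ℕ)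
    (𝔯 : ResY N θ Mstar) (𝔢₀ : SectEY N θ Mstar) {γ₀ BP KJ δ δV : ℝ} (hγ₀ : 0 < γ₀) (hBP : 0 ≤ BP) (hKJ : 0 ≤ KJ) (hδ : 0 < δ) (hδV : 0 ≤ δV)
    (hsmall : (θ.ℓ₆ : ℝ) * (2 * δV) < 1)
    (t D : ℕ) {ϰ : ℝ} (hϰ : 0 < ϰ) {p₀ σ' c κ' : ℝ} (hp₀ : 2 / 3 < p₀) (hσ : 0 < σ') (hc : 0 ≤ c) (hκ : 0 < κ') (hκσ : κ' < σ' * (t + 1)) :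
    ∃ b₁ : ℝ, ∀ b₀ : ℝ, b₁ < b₀ → ∃ C : ℝ, 0 ≤ C ∧ ∀ η : ℝ, 0 < η → η ≤ 1 →
      ∀ (x : MemberY θ.d₆ θ.ℓ₆ θ.hd' θ.hL' θ.b₀ θ.b₁ Mstar) [DecidableEq (IBondY x.toKIdx)]
        {G : Subgroup (Matrix (Fin N) (Fin N) ℂ)ˣ}, G ≤ unitaryUnits (Matrix (Fin N) (Fin N) ℂ) →
      ∀ (U : CfgY (Matrix (Fin N) (Fin N) ℂ) x.toKIdx), (∀ μ z, U μ z ∈ G) →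
        (∀ c' : CBondStY x, ¬ GoodY x c'.1.1 → ∀ i : ℕ, i < θ.ℓ₆ →
          ‖((avYOfRecord x U ⟨ofZ x (labK x c'.1.1 + (i : ℤ) • unitVec c'.1.2), c'.1.2⟩ : (Matrix (Fin N) (Fin N) ℂ)ˣ) :
              Matrix (Fin N) (Fin N) ℂ) - 1‖ ≤ δV) →
        IsSymmTr (fun _ => (1 : ℝ)) ((𝔯 x).Δ2 U) → IsSymmTr (fun _ => (1 : ℝ)) ((𝔢₀ x).D2J U) →
      ∀ {σ : Type} [Fintype σ] [DecidableEq σ] [Nonempty σ] (ι : σ → IBondY x.toKIdx), Function.Injective ι → (∀ s, lamTstY x (ι s)) →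
        (∀ u v : IBondY x.toKIdx, inΛstY x u → inΛstY x v →
          (⨆ E : BallY (Matrix (Fin N) (Fin N) ℂ), ‖(((etaDY x : ℝ) : ℂ) • (lettersYOfRecordV4P N θ Mstar 𝔯 x).QG1Qinv U)
              (deltaY v (E : Matrix (Fin N) (Fin N) ℂ)) u‖) ≤ BP * Real.exp (-(δ * unitDistY x u v))) →
        (∀ (u v : IBondY x.toKIdx) (E : Matrix (Fin N) (Fin N) ℂ), inΛstY x u → inΛstY x v →
          ‖((((etaDY x : ℝ) : ℂ) • (aY x.toKIdx + (𝔢₀ x).D2J U)).restrictScalars ℝ) (Pi.single v E) u‖ ≤ KJ * ‖E‖ * Real.exp (-(δ * unitDistY x u v))) →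
        (∀ B : IBondY x.toKIdx → Matrix (Fin N) (Fin N) ℂ, (∀ q, ¬ inΛstY x q → B q = 0) → (∀ q, IsAxialY x q → B q = 0) →
          (∀ c' : CBondStY x, Q1Y x (avYOfRecord x) U c'.1 B = 0) →
          γ₀ * trIP (fun _ => (1 : ℝ)) B B ≤
            trIP (fun _ => (1 : ℝ)) B (deltaKPstY x (lettersYOfRecordV4P N θ Mstar 𝔯 x) (sectEStYOfRecordV7 N θ Mstar 𝔢₀ x) U B)) →
      ∃ (Λ : Finset (B1Eq324BenfattoLemma.Site (θ.d₆ + 1 + (θ.d₆ + 1) + 1))) (e' : σ × TrIdx N ≃ ↥Λ),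
        ((gaussianFieldOfKernel fun u w => if h : u ∈ Λ ∧ w ∈ Λ then
            ((Matrix.reindex e' e'
              (Matrix.of fun p q : σ × TrIdx N =>
                  trReForm (trBasis N p.2) (((CsDeltaCPstY x (lettersYOfRecordV4P N θ Mstar 𝔯 x)
            (sectEStYOfRecordV7 N θ Mstar 𝔢₀ x) U).restrictScalars ℝ)
                    (Pi.single (ι q.1) (trBasis N q.2)) (ι p.1))))⁻¹ :
                Matrix ↥Λ ↥Λ ℝ) ⟨u, h.1⟩ ⟨w, h.2⟩ else 0).map
            (fun (z : B1Eq324BenfattoLemma.Site (θ.d₆ + 1 + (θ.d₆ + 1) + 1) → ℝ) (q : σ × TrIdx N) => z ((e' q : ↥Λ) : B1Eq324BenfattoLemma.Site (θ.d₆ + 1 + (θ.d₆ + 1) + 1))) =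
          gaussianFieldOfKernel fun p q =>
            ((Matrix.of fun p q : σ × TrIdx N =>
                trReForm (trBasis N p.2) (((CsDeltaCPstY x (lettersYOfRecordV4P N θ Mstar 𝔯 x)
            (sectEStYOfRecordV7 N θ Mstar 𝔢₀ x) U).restrictScalars ℝ)
                  (Pi.single (ι q.1) (trBasis N q.2)) (ι p.1)))⁻¹ :
              Matrix (σ × TrIdx N) (σ × TrIdx N) ℝ) p q) ∧
        (∀ p : ℝ, 0 ≤ p →
          ((fun (z : B1Eq324BenfattoLemma.Site (θ.d₆ + 1 + (θ.d₆ + 1) + 1) → ℝ) (q : σ × TrIdx N) => z ((e' q : ↥Λ) : B1Eq324BenfattoLemma.Site (θ.d₆ + 1 + (θ.d₆ + 1) + 1))) ⁻¹'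
              {ω : σ × TrIdx N → ℝ | ∀ q, |ω q| ≤ p}) =ᵐ[gaussianFieldOfKernel fun u w => if h : u ∈ Λ ∧ w ∈ Λ then
                ((Matrix.reindex e' e'
                  (Matrix.of fun p q : σ × TrIdx N =>
                      trReForm (trBasis N p.2) (((CsDeltaCPstY x (lettersYOfRecordV4P N θ Mstar 𝔯 x)
            (sectEStYOfRecordV7 N θ Mstar 𝔢₀ x) U).restrictScalars ℝ)
                        (Pi.single (ι q.1) (trBasis N q.2)) (ι p.1))))⁻¹ :
                    Matrix ↥Λ ↥Λ ℝ) ⟨u, h.1⟩ ⟨w, h.2⟩ else 0]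
            smallFieldSet Λ p) ∧
        ∀ (s : ℕ) (I J : Finset (B1Eq324BenfattoLemma.Site (θ.d₆ + 1 + (θ.d₆ + 1) + 1))) (𝔞 : Coef (θ.d₆ + 1 + (θ.d₆ + 1) + 1)),
          I.Nonempty → J ⊆ I → J ⊆ Λ → coefSup s D 𝔞 J ≤ c * η ^ σ' →
          0 < ∫ z, cutoffBoltzmann (hamiltonian s D ϰ 𝔞 J) I (B10.pFun b₀ p₀ η) z ∂(gaussianFieldOfKernel fun u w => if h : u ∈ Λ ∧ w ∈ Λ then
              ((Matrix.reindex e' e'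
                (Matrix.of fun p q : σ × TrIdx N =>
                    trReForm (trBasis N p.2) (((CsDeltaCPstY x (lettersYOfRecordV4P N θ Mstar 𝔯 x)
            (sectEStYOfRecordV7 N θ Mstar 𝔢₀ x) U).restrictScalars ℝ)
                      (Pi.single (ι q.1) (trBasis N q.2)) (ι p.1))))⁻¹ :
                  Matrix ↥Λ ↥Λ ℝ) ⟨u, h.1⟩ ⟨w, h.2⟩ else 0) ∧
            |Real.log (∫ z, cutoffBoltzmann (hamiltonian s D ϰ 𝔞 J) I (B10.pFun b₀ p₀ η) z ∂(gaussianFieldOfKernel fun u w =>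
                if h : u ∈ Λ ∧ w ∈ Λ then
                  ((Matrix.reindex e' e'
                    (Matrix.of fun p q : σ × TrIdx N =>
                        trReForm (trBasis N p.2) (((CsDeltaCPstY x (lettersYOfRecordV4P N θ Mstar 𝔯 x)
            (sectEStYOfRecordV7 N θ Mstar 𝔢₀ x) U).restrictScalars ℝ)
                          (Pi.single (ι q.1) (trBasis N q.2)) (ι p.1))))⁻¹ :
                      Matrix ↥Λ ↥Λ ℝ) ⟨u, h.1⟩ ⟨w, h.2⟩ else 0)) -
              cumulantSum (gaussianFieldOfKernel fun u w => if h : u ∈ Λ ∧ w ∈ Λ then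
                  ((Matrix.reindex e' e'
                    (Matrix.of fun p q : σ × TrIdx N =>
                        trReForm (trBasis N p.2) (((CsDeltaCPstY x (lettersYOfRecordV4P N θ Mstar 𝔯 x)
            (sectEStYOfRecordV7 N θ Mstar 𝔢₀ x) U).restrictScalars ℝ)
                          (Pi.single (ι q.1) (trBasis N q.2)) (ι p.1))))⁻¹ :
                      Matrix ↥Λ ↥Λ ℝ) ⟨u, h.1⟩ ⟨w, h.2⟩ else 0)
                (hamiltonian s D ϰ 𝔞 J) t| ≤ C * η ^ κ' * I.card := by
  -- `κ_K := (1 − ℓ·2δ_V)⁻¹ ≥ 0`; then p708018 §4 `_of_units` with the three pivot rows of §1 (good-source: exact; bad-source: line-small)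
  have hκK : (0 : ℝ) ≤ (1 - (θ.ℓ₆ : ℝ) * (2 * δV))⁻¹ := inv_nonneg.2 (sub_nonneg.2 hsmall.le)
  obtain ⟨b₁, hb₁⟩ := eq324_CsDeltaCPstY_lettersYOfRecordV4P_sectEStYOfRecordV7_trBasis_of_units_onΛst_on_unit N θ Mstar 𝔯 𝔢₀ hγ₀ hBP hKJ hδ hκK
    t D hϰ hp₀ hσ hc hκ hκσ
  refine ⟨b₁, fun b₀ hb₀ => ?_⟩
  obtain ⟨C, hC, hE⟩ := hb₁ b₀ hb₀
  refine ⟨C, hC, ?_⟩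
  intro η hη hηle x _ G hG U hU hV hΔ2 hD2J σ _ _ _ ι hι hιT hProw hJker hco
  obtain ⟨hK, hKT, hKinv⟩ := star_pivot_rows_avYOfRecord_of_pivotLines N θ Mstar x hG hU hδV hV hsmall
  exact hE η hη hηle x hG U hU hΔ2 hD2J ι hι hιT hProw hJker hK hKT hKinv hco

/-- ★★★ **… WITH THE P-ROW BY NAME** at def-Y's STAR v4P record: `B9.Ineq3132 (d+1) ((opsYNuStOfRecordV4PE N θ M⋆ 𝔯 𝔢st 𝔴 𝔈 x).QG1Qinv) B_P δ U` read on STAR pairs by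
`…PrecisionDoorRecordV4P.pRowOnΛst_opsYNuStOfRecordV4PE_of_ineq3132`; otherwise as the door above.
[cite: Balaban1985BackgroundPropagators, (3.132) p.422, Thm 3.12 p.423, (3.35) p.396, (3.155)–(3.158) pp.427–428; Balaban1984PropagatorsII, (2.149) p.249, (2.3) p.224,
Lemma 2.4 p.245; Balaban1985Averaging, (125)–(126) p.36; Balaban1985UV3, (24) p.262, pp.271–272; Balaban1982Higgs1, (3.24) p.616; BenfattoEtAl1978, Lemma (4.5)–(4.7)
p.152 (class form; bent window, presentation and coordinates ours)] -/
theorem eq324_CsDeltaCPstY_lettersYOfRecordV4P_sectEStYOfRecordV7_trBasis_of_ineq3132_of_pivotLines_onΛst_on_unit (N : ℕ) [NeZero N] (θ : Stage3Params) (Mstar : ℕ)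
    (𝔯 : ResY N θ Mstar) (𝔢₀ : SectEY N θ Mstar) (𝔢st : SectEStY N θ Mstar) (𝔴 : RWEY N θ Mstar) (𝔈 : ExpsY N θ Mstar) {γ₀ BP KJ δ δV : ℝ} (hγ₀ : 0 < γ₀) (hBP : 0 ≤ BP)
    (hKJ : 0 ≤ KJ) (hδ : 0 < δ) (hδV : 0 ≤ δV)
    (hsmall : (θ.ℓ₆ : ℝ) * (2 * δV) < 1)
    (t D : ℕ) {ϰ : ℝ} (hϰ : 0 < ϰ) {p₀ σ' c κ' : ℝ} (hp₀ : 2 / 3 < p₀) (hσ : 0 < σ') (hc : 0 ≤ c) (hκ : 0 < κ') (hκσ : κ' < σ' * (t + 1)) :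
    ∃ b₁ : ℝ, ∀ b₀ : ℝ, b₁ < b₀ → ∃ C : ℝ, 0 ≤ C ∧ ∀ η : ℝ, 0 < η → η ≤ 1 →
      ∀ (x : MemberY θ.d₆ θ.ℓ₆ θ.hd' θ.hL' θ.b₀ θ.b₁ Mstar) [DecidableEq (IBondY x.toKIdx)]
        {G : Subgroup (Matrix (Fin N) (Fin N) ℂ)ˣ}, G ≤ unitaryUnits (Matrix (Fin N) (Fin N) ℂ) →
      ∀ (U : CfgY (Matrix (Fin N) (Fin N) ℂ) x.toKIdx), (∀ μ z, U μ z ∈ G) →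
        (∀ c' : CBondStY x, ¬ GoodY x c'.1.1 → ∀ i : ℕ, i < θ.ℓ₆ →
          ‖((avYOfRecord x U ⟨ofZ x (labK x c'.1.1 + (i : ℤ) • unitVec c'.1.2), c'.1.2⟩ : (Matrix (Fin N) (Fin N) ℂ)ˣ) :
              Matrix (Fin N) (Fin N) ℂ) - 1‖ ≤ δV) →
        IsSymmTr (fun _ => (1 : ℝ)) ((𝔯 x).Δ2 U) → IsSymmTr (fun _ => (1 : ℝ)) ((𝔢₀ x).D2J U) →
      ∀ {σ : Type} [Fintype σ] [DecidableEq σ] [Nonempty σ] (ι : σ → IBondY x.toKIdx), Function.Injective ι → (∀ s, lamTstY x (ι s)) →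
        B9.Ineq3132 (θ.d₆ + 1) (opsYNuStOfRecordV4PE N θ Mstar 𝔯 𝔢st 𝔴 𝔈 x).QG1Qinv BP δ U →
        (∀ (u v : IBondY x.toKIdx) (E : Matrix (Fin N) (Fin N) ℂ), inΛstY x u → inΛstY x v →
          ‖((((etaDY x : ℝ) : ℂ) • (aY x.toKIdx + (𝔢₀ x).D2J U)).restrictScalars ℝ) (Pi.single v E) u‖ ≤ KJ * ‖E‖ * Real.exp (-(δ * unitDistY x u v))) →
        (∀ B : IBondY x.toKIdx → Matrix (Fin N) (Fin N) ℂ, (∀ q, ¬ inΛstY x q → B q = 0) → (∀ q, IsAxialY x q → B q = 0) →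
          (∀ c' : CBondStY x, Q1Y x (avYOfRecord x) U c'.1 B = 0) →
          γ₀ * trIP (fun _ => (1 : ℝ)) B B ≤
            trIP (fun _ => (1 : ℝ)) B (deltaKPstY x (lettersYOfRecordV4P N θ Mstar 𝔯 x) (sectEStYOfRecordV7 N θ Mstar 𝔢₀ x) U B)) →
      ∃ (Λ : Finset (B1Eq324BenfattoLemma.Site (θ.d₆ + 1 + (θ.d₆ + 1) + 1))) (e' : σ × TrIdx N ≃ ↥Λ),
        ((gaussianFieldOfKernel fun u w => if h : u ∈ Λ ∧ w ∈ Λ then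
            ((Matrix.reindex e' e'
              (Matrix.of fun p q : σ × TrIdx N =>
                  trReForm (trBasis N p.2) (((CsDeltaCPstY x (lettersYOfRecordV4P N θ Mstar 𝔯 x)
            (sectEStYOfRecordV7 N θ Mstar 𝔢₀ x) U).restrictScalars ℝ)
                    (Pi.single (ι q.1) (trBasis N q.2)) (ι p.1))))⁻¹ :
                Matrix ↥Λ ↥Λ ℝ) ⟨u, h.1⟩ ⟨w, h.2⟩ else 0).map
            (fun (z : B1Eq324BenfattoLemma.Site (θ.d₆ + 1 + (θ.d₆ + 1) + 1) → ℝ) (q : σ × TrIdx N) => z ((e' q : ↥Λ) : B1Eq324BenfattoLemma.Site (θ.d₆ + 1 + (θ.d₆ + 1) + 1))) =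
          gaussianFieldOfKernel fun p q =>
            ((Matrix.of fun p q : σ × TrIdx N =>
                trReForm (trBasis N p.2) (((CsDeltaCPstY x (lettersYOfRecordV4P N θ Mstar 𝔯 x)
            (sectEStYOfRecordV7 N θ Mstar 𝔢₀ x) U).restrictScalars ℝ)
                  (Pi.single (ι q.1) (trBasis N q.2)) (ι p.1)))⁻¹ :
              Matrix (σ × TrIdx N) (σ × TrIdx N) ℝ) p q) ∧
        (∀ p : ℝ, 0 ≤ p →
          ((fun (z : B1Eq324BenfattoLemma.Site (θ.d₆ + 1 + (θ.d₆ + 1) + 1) → ℝ) (q : σ × TrIdx N) => z ((e' q : ↥Λ) : B1Eq324BenfattoLemma.Site (θ.d₆ + 1 + (θ.d₆ + 1) + 1))) ⁻¹'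
              {ω : σ × TrIdx N → ℝ | ∀ q, |ω q| ≤ p}) =ᵐ[gaussianFieldOfKernel fun u w => if h : u ∈ Λ ∧ w ∈ Λ then
                ((Matrix.reindex e' e'
                  (Matrix.of fun p q : σ × TrIdx N =>
                      trReForm (trBasis N p.2) (((CsDeltaCPstY x (lettersYOfRecordV4P N θ Mstar 𝔯 x)
            (sectEStYOfRecordV7 N θ Mstar 𝔢₀ x) U).restrictScalars ℝ)
                        (Pi.single (ι q.1) (trBasis N q.2)) (ι p.1))))⁻¹ :
                    Matrix ↥Λ ↥Λ ℝ) ⟨u, h.1⟩ ⟨w, h.2⟩ else 0]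
            smallFieldSet Λ p) ∧
        ∀ (s : ℕ) (I J : Finset (B1Eq324BenfattoLemma.Site (θ.d₆ + 1 + (θ.d₆ + 1) + 1))) (𝔞 : Coef (θ.d₆ + 1 + (θ.d₆ + 1) + 1)),
          I.Nonempty → J ⊆ I → J ⊆ Λ → coefSup s D 𝔞 J ≤ c * η ^ σ' →
          0 < ∫ z, cutoffBoltzmann (hamiltonian s D ϰ 𝔞 J) I (B10.pFun b₀ p₀ η) z ∂(gaussianFieldOfKernel fun u w => if h : u ∈ Λ ∧ w ∈ Λ then
              ((Matrix.reindex e' e'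
                (Matrix.of fun p q : σ × TrIdx N =>
                    trReForm (trBasis N p.2) (((CsDeltaCPstY x (lettersYOfRecordV4P N θ Mstar 𝔯 x)
            (sectEStYOfRecordV7 N θ Mstar 𝔢₀ x) U).restrictScalars ℝ)
                      (Pi.single (ι q.1) (trBasis N q.2)) (ι p.1))))⁻¹ :
                  Matrix ↥Λ ↥Λ ℝ) ⟨u, h.1⟩ ⟨w, h.2⟩ else 0) ∧
            |Real.log (∫ z, cutoffBoltzmann (hamiltonian s D ϰ 𝔞 J) I (B10.pFun b₀ p₀ η) z ∂(gaussianFieldOfKernel fun u w =>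
                if h : u ∈ Λ ∧ w ∈ Λ then
                  ((Matrix.reindex e' e'
                    (Matrix.of fun p q : σ × TrIdx N =>
                        trReForm (trBasis N p.2) (((CsDeltaCPstY x (lettersYOfRecordV4P N θ Mstar 𝔯 x)
            (sectEStYOfRecordV7 N θ Mstar 𝔢₀ x) U).restrictScalars ℝ)
                          (Pi.single (ι q.1) (trBasis N q.2)) (ι p.1))))⁻¹ :
                      Matrix ↥Λ ↥Λ ℝ) ⟨u, h.1⟩ ⟨w, h.2⟩ else 0)) -
              cumulantSum (gaussianFieldOfKernel fun u w => if h : u ∈ Λ ∧ w ∈ Λ then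
                  ((Matrix.reindex e' e'
                    (Matrix.of fun p q : σ × TrIdx N =>
                        trReForm (trBasis N p.2) (((CsDeltaCPstY x (lettersYOfRecordV4P N θ Mstar 𝔯 x)
            (sectEStYOfRecordV7 N θ Mstar 𝔢₀ x) U).restrictScalars ℝ)
                          (Pi.single (ι q.1) (trBasis N q.2)) (ι p.1))))⁻¹ :
                      Matrix ↥Λ ↥Λ ℝ) ⟨u, h.1⟩ ⟨w, h.2⟩ else 0)
                (hamiltonian s D ϰ 𝔞 J) t| ≤ C * η ^ κ' * I.card := by
  obtain ⟨b₁, hb₁⟩ := eq324_CsDeltaCPstY_lettersYOfRecordV4P_sectEStYOfRecordV7_trBasis_of_pivotLines_onΛst_on_unit N θ Mstar 𝔯 𝔢₀ hγ₀ hBP hKJ hδ hδV hsmall t D hϰ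
    hp₀ hσ hc hκ hκσ
  refine ⟨b₁, fun b₀ hb₀ => ?_⟩
  obtain ⟨C, hC, hE⟩ := hb₁ b₀ hb₀
  refine ⟨C, hC, ?_⟩
  intro η hη hηle x _ G hG U hU hV hΔ2 hD2J σ _ _ _ ι hι hιT h3132 hJker hco
  exact hE η hη hηle x hG U hU hV hΔ2 hD2J ι hι hιT
    (fun u v hu hv => pRowOnΛst_opsYNuStOfRecordV4PE_of_ineq3132 θ Mstar 𝔯 𝔢st 𝔴 𝔈 x (θ.d₆ + 1) hBP hδ.le U h3132 hu hv) hJker hco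


/-- ★★★ **FAMILY FORM AT PRINT's CLASS `bg9YP`** — the door above under the (3.132) CLAIM `B9.Stmt3132Printed (d+1) c35 geo9Y (bg9YP SU(N)) (siteKernelP ∘ ….QGQinv)
(siteKernelP ∘ ….QG1Qinv)` for def-Y's STAR v4P record (the field `s3132` of `B9LeafX (Y9OfRecordP …)` at `c35 := c35Y`): print's thresholds `M₄`, `a₀`, ONE rate `δ`;
regime print's (3.35)–(3.36) at print's cube class (`U` is `SU(N)`-valued, `mem_of_reg335P`) + the pivot-line smallness of `V` at bad-source star corners.
[cite: Balaban1985BackgroundPropagators, (3.132) p.422, Thm 3.12 p.423, (3.35)–(3.36) p.396, (3.155)–(3.158) pp.427–428; Balaban1984PropagatorsII, (2.149) p.249,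
(2.3) p.224, Lemma 2.4 p.245; Balaban1985Averaging, (125)–(126) p.36; Balaban1985UV3, (24) p.262, pp.271–272; Balaban1982Higgs1, (3.24) p.616; BenfattoEtAl1978, Lemma
(4.5)–(4.7) p.152 (class form; bent window, presentation and coordinates ours)] -/
theorem eq324_CsDeltaCPstY_lettersYOfRecordV4P_sectEStYOfRecordV7_trBasis_of_stmt3132Printed_P_of_pivotLines_onΛst_on_unit (N : ℕ) [NeZero N] (θ : Stage3Params) (Mstar : ℕ)
    (𝔯 : ResY N θ Mstar) (𝔢₀ : SectEY N θ Mstar) (𝔢st : SectEStY N θ Mstar) (𝔴 : RWEY N θ Mstar) (𝔈 : ExpsY N θ Mstar) {c35 : ℝ}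
    (h26 : B9.Stmt3132Printed (θ.d₆ + 1) c35
      (geo9Y (d := θ.d₆) (ℓ := θ.ℓ₆) (hd := θ.hd') (hL := θ.hL') (b₀ := θ.b₀) (b₁ := θ.b₁) (Mstar := Mstar))
      (bg9YP (Matrix (Fin N) (Fin N) ℂ) (specialUnitaryUnits (Fin N)))
      (fun x => siteKernelP (opsYNuStOfRecordV4PE N θ Mstar 𝔯 𝔢st 𝔴 𝔈 x).QGQinv)
      (fun x => siteKernelP (opsYNuStOfRecordV4PE N θ Mstar 𝔯 𝔢st 𝔴 𝔈 x).QG1Qinv))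
    {γ₀ KJ δV : ℝ} (hγ₀ : 0 < γ₀) (hKJ : 0 ≤ KJ) (hδV : 0 ≤ δV)
    (hsmall : (θ.ℓ₆ : ℝ) * (2 * δV) < 1)
    (t D : ℕ) {ϰ : ℝ} (hϰ : 0 < ϰ) {p₀ σ' c κ' : ℝ} (hp₀ : 2 / 3 < p₀) (hσ : 0 < σ') (hc : 0 ≤ c) (hκ : 0 < κ') (hκσ : κ' < σ' * (t + 1)) :
    ∃ M₄ δ a₀ : ℝ, 0 < M₄ ∧ 0 < δ ∧ 0 < a₀ ∧ ∃ b₁ : ℝ, ∀ b₀ : ℝ, b₁ < b₀ → ∃ C : ℝ, 0 ≤ C ∧ ∀ η : ℝ, 0 < η → η ≤ 1 →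
      ∀ (x : MemberY θ.d₆ θ.ℓ₆ θ.hd' θ.hL' θ.b₀ θ.b₁ Mstar) [DecidableEq (IBondY x.toKIdx)], M₄ ≤ (geo9Y x).M →
      ∀ α₀ : ℝ, 0 < α₀ → (geo9Y x).M * α₀ ≤ a₀ →
      ∀ (U : CfgY (Matrix (Fin N) (Fin N) ℂ) x.toKIdx),
        (bg9YP (Matrix (Fin N) (Fin N) ℂ) (specialUnitaryUnits (Fin N)) x).Reg335 c35 α₀ U →
        (bg9YP (Matrix (Fin N) (Fin N) ℂ) (specialUnitaryUnits (Fin N)) x).Reg336 c35 α₀ U →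
        (∀ c' : CBondStY x, ¬ GoodY x c'.1.1 → ∀ i : ℕ, i < θ.ℓ₆ →
          ‖((avYOfRecord x U ⟨ofZ x (labK x c'.1.1 + (i : ℤ) • unitVec c'.1.2), c'.1.2⟩ : (Matrix (Fin N) (Fin N) ℂ)ˣ) :
              Matrix (Fin N) (Fin N) ℂ) - 1‖ ≤ δV) →
        IsSymmTr (fun _ => (1 : ℝ)) ((𝔯 x).Δ2 U) → IsSymmTr (fun _ => (1 : ℝ)) ((𝔢₀ x).D2J U) →
      ∀ {σ : Type} [Fintype σ] [DecidableEq σ] [Nonempty σ] (ι : σ → IBondY x.toKIdx), Function.Injective ι → (∀ s, lamTstY x (ι s)) →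
        (∀ (u v : IBondY x.toKIdx) (E : Matrix (Fin N) (Fin N) ℂ), inΛstY x u → inΛstY x v →
          ‖((((etaDY x : ℝ) : ℂ) • (aY x.toKIdx + (𝔢₀ x).D2J U)).restrictScalars ℝ) (Pi.single v E) u‖ ≤ KJ * ‖E‖ * Real.exp (-(δ * unitDistY x u v))) →
        (∀ B : IBondY x.toKIdx → Matrix (Fin N) (Fin N) ℂ, (∀ q, ¬ inΛstY x q → B q = 0) → (∀ q, IsAxialY x q → B q = 0) →
          (∀ c' : CBondStY x, Q1Y x (avYOfRecord x) U c'.1 B = 0) →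
          γ₀ * trIP (fun _ => (1 : ℝ)) B B ≤
            trIP (fun _ => (1 : ℝ)) B (deltaKPstY x (lettersYOfRecordV4P N θ Mstar 𝔯 x) (sectEStYOfRecordV7 N θ Mstar 𝔢₀ x) U B)) →
      ∃ (Λ : Finset (B1Eq324BenfattoLemma.Site (θ.d₆ + 1 + (θ.d₆ + 1) + 1))) (e' : σ × TrIdx N ≃ ↥Λ),
        ((gaussianFieldOfKernel fun u w => if h : u ∈ Λ ∧ w ∈ Λ then
            ((Matrix.reindex e' e'
              (Matrix.of fun p q : σ × TrIdx N =>
                  trReForm (trBasis N p.2) (((CsDeltaCPstY x (lettersYOfRecordV4P N θ Mstar 𝔯 x)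
            (sectEStYOfRecordV7 N θ Mstar 𝔢₀ x) U).restrictScalars ℝ)
                    (Pi.single (ι q.1) (trBasis N q.2)) (ι p.1))))⁻¹ :
                Matrix ↥Λ ↥Λ ℝ) ⟨u, h.1⟩ ⟨w, h.2⟩ else 0).map
            (fun (z : B1Eq324BenfattoLemma.Site (θ.d₆ + 1 + (θ.d₆ + 1) + 1) → ℝ) (q : σ × TrIdx N) => z ((e' q : ↥Λ) : B1Eq324BenfattoLemma.Site (θ.d₆ + 1 + (θ.d₆ + 1) + 1))) =
          gaussianFieldOfKernel fun p q =>
            ((Matrix.of fun p q : σ × TrIdx N =>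
                trReForm (trBasis N p.2) (((CsDeltaCPstY x (lettersYOfRecordV4P N θ Mstar 𝔯 x)
            (sectEStYOfRecordV7 N θ Mstar 𝔢₀ x) U).restrictScalars ℝ)
                  (Pi.single (ι q.1) (trBasis N q.2)) (ι p.1)))⁻¹ :
              Matrix (σ × TrIdx N) (σ × TrIdx N) ℝ) p q) ∧
        (∀ p : ℝ, 0 ≤ p →
          ((fun (z : B1Eq324BenfattoLemma.Site (θ.d₆ + 1 + (θ.d₆ + 1) + 1) → ℝ) (q : σ × TrIdx N) => z ((e' q : ↥Λ) : B1Eq324BenfattoLemma.Site (θ.d₆ + 1 + (θ.d₆ + 1) + 1))) ⁻¹'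
              {ω : σ × TrIdx N → ℝ | ∀ q, |ω q| ≤ p}) =ᵐ[gaussianFieldOfKernel fun u w => if h : u ∈ Λ ∧ w ∈ Λ then
                ((Matrix.reindex e' e'
                  (Matrix.of fun p q : σ × TrIdx N =>
                      trReForm (trBasis N p.2) (((CsDeltaCPstY x (lettersYOfRecordV4P N θ Mstar 𝔯 x)
            (sectEStYOfRecordV7 N θ Mstar 𝔢₀ x) U).restrictScalars ℝ)
                        (Pi.single (ι q.1) (trBasis N q.2)) (ι p.1))))⁻¹ :
                    Matrix ↥Λ ↥Λ ℝ) ⟨u, h.1⟩ ⟨w, h.2⟩ else 0]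
            smallFieldSet Λ p) ∧
        ∀ (s : ℕ) (I J : Finset (B1Eq324BenfattoLemma.Site (θ.d₆ + 1 + (θ.d₆ + 1) + 1))) (𝔞 : Coef (θ.d₆ + 1 + (θ.d₆ + 1) + 1)),
          I.Nonempty → J ⊆ I → J ⊆ Λ → coefSup s D 𝔞 J ≤ c * η ^ σ' →
          0 < ∫ z, cutoffBoltzmann (hamiltonian s D ϰ 𝔞 J) I (B10.pFun b₀ p₀ η) z ∂(gaussianFieldOfKernel fun u w => if h : u ∈ Λ ∧ w ∈ Λ then
              ((Matrix.reindex e' e'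
                (Matrix.of fun p q : σ × TrIdx N =>
                    trReForm (trBasis N p.2) (((CsDeltaCPstY x (lettersYOfRecordV4P N θ Mstar 𝔯 x)
            (sectEStYOfRecordV7 N θ Mstar 𝔢₀ x) U).restrictScalars ℝ)
                      (Pi.single (ι q.1) (trBasis N q.2)) (ι p.1))))⁻¹ :
                  Matrix ↥Λ ↥Λ ℝ) ⟨u, h.1⟩ ⟨w, h.2⟩ else 0) ∧
            |Real.log (∫ z, cutoffBoltzmann (hamiltonian s D ϰ 𝔞 J) I (B10.pFun b₀ p₀ η) z ∂(gaussianFieldOfKernel fun u w =>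
                if h : u ∈ Λ ∧ w ∈ Λ then
                  ((Matrix.reindex e' e'
                    (Matrix.of fun p q : σ × TrIdx N =>
                        trReForm (trBasis N p.2) (((CsDeltaCPstY x (lettersYOfRecordV4P N θ Mstar 𝔯 x)
            (sectEStYOfRecordV7 N θ Mstar 𝔢₀ x) U).restrictScalars ℝ)
                          (Pi.single (ι q.1) (trBasis N q.2)) (ι p.1))))⁻¹ :
                      Matrix ↥Λ ↥Λ ℝ) ⟨u, h.1⟩ ⟨w, h.2⟩ else 0)) -
              cumulantSum (gaussianFieldOfKernel fun u w => if h : u ∈ Λ ∧ w ∈ Λ then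
                  ((Matrix.reindex e' e'
                    (Matrix.of fun p q : σ × TrIdx N =>
                        trReForm (trBasis N p.2) (((CsDeltaCPstY x (lettersYOfRecordV4P N θ Mstar 𝔯 x)
            (sectEStYOfRecordV7 N θ Mstar 𝔢₀ x) U).restrictScalars ℝ)
                          (Pi.single (ι q.1) (trBasis N q.2)) (ι p.1))))⁻¹ :
                      Matrix ↥Λ ↥Λ ℝ) ⟨u, h.1⟩ ⟨w, h.2⟩ else 0)
                (hamiltonian s D ϰ 𝔞 J) t| ≤ C * η ^ κ' * I.card := by
  obtain ⟨M₄, δ, a₀, BP, hM₄, hδ, ha₀, hBP, H⟩ := h26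
  obtain ⟨b₁, hb₁⟩ := eq324_CsDeltaCPstY_lettersYOfRecordV4P_sectEStYOfRecordV7_trBasis_of_ineq3132_of_pivotLines_onΛst_on_unit N θ Mstar 𝔯 𝔢₀ 𝔢st 𝔴 𝔈 hγ₀ hBP.le
    hKJ hδ hδV hsmall t D hϰ hp₀ hσ hc hκ hκσ
  refine ⟨M₄, δ, a₀, hM₄, hδ, ha₀, b₁, fun b₀ hb₀ => ?_⟩
  obtain ⟨C, hC, hE⟩ := hb₁ b₀ hb₀
  refine ⟨C, hC, ?_⟩
  intro η hη hηle x _ hMx α₀ hα₀ hMa U h335 h336 hV hΔ2 hD2J σ _ _ _ ι hι hιT hJker hco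
  exact hE η hη hηle x specialUnitaryUnits_le_unitaryUnits U (B9BackgroundsKLevelV1P.mem_of_reg335P x.toKIdx h335.1) hV hΔ2 hD2J ι hι hιT
    (H x hMx α₀ hα₀ hMa U h335 h336).2 hJker hco


/-- ★★★★ **THE (3.24) STAR DOOR OF RECORD MODULO NODE N06's SOCKET OF RECORD, NODE 00's LAST REGIME ROW CONFINED TO THE BAD-SOURCE PIVOT LINES** — from
`h06 : B9LeafX (Y9OfRecordP N θ M⋆ (opsYNuStOfRecordV4PE N θ M⋆ 𝔯 𝔢st 𝔴 𝔈))` (the hypothesis the K1 face of node N24 and node N07 consume, the conclusion of dag-n06-d's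
STAR-edition certificate; its field `s3132` is the door's P-row), under print's regime (3.35)–(3.36) at print's cube class and «`V = avYOfRecord x U` `δ_V`-small on the `ℓ`
pivot-line bonds of each star corner with a bad source block, `ℓ·2δ_V < 1`» (nothing at good-source corners).  Displayed per background beyond that: [5]'s reality
`IsSymmTr ((𝔯 x).Δ2 U)` ∕ `IsSymmTr ((𝔢₀ x).D2J U)`, the 𝒥-row on STAR pairs at the leaf's rate `δ` ((3.136)-type, through a generic `(𝔢₀ x).D2J`), the Δ_k-row `γ₀` on
print's `V`-constrained STAR subspace (G-B9-09).
[cite: Balaban1985BackgroundPropagators, (3.132) p.422, Thm 3.12 p.423, (3.35)–(3.36) p.396, (3.155)–(3.158) pp.427–428, Thms 3.1–3.15 pp.397–432 (the leaf);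
Balaban1984PropagatorsII, (2.149) p.249, (2.3) p.224, Lemma 2.4 p.245; Balaban1985Averaging, (14) p.19, (125)–(126) p.36; Balaban1985UV3, (24) p.262, pp.271–272;
Balaban1982Higgs1, (3.24) p.616; BenfattoEtAl1978, Lemma (4.5)–(4.7) p.152 (class form; bent window, presentation and coordinates ours)] -/
theorem eq324_CsDeltaCPstY_lettersYOfRecordV4P_sectEStYOfRecordV7_trBasis_of_b9LeafX_of_pivotLines_onΛst_on_unit (N : ℕ) [NeZero N] (θ : Stage3Params) (Mstar : ℕ)
    (𝔯 : ResY N θ Mstar) (𝔢₀ : SectEY N θ Mstar) (𝔢st : SectEStY N θ Mstar) (𝔴 : RWEY N θ Mstar) (𝔈 : ExpsY N θ Mstar) 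
    (h06 : B9LeafX (Y9OfRecordP N θ Mstar (opsYNuStOfRecordV4PE N θ Mstar 𝔯 𝔢st 𝔴 𝔈)))
    {γ₀ KJ δV : ℝ} (hγ₀ : 0 < γ₀) (hKJ : 0 ≤ KJ) (hδV : 0 ≤ δV)
    (hsmall : (θ.ℓ₆ : ℝ) * (2 * δV) < 1)
    (t D : ℕ) {ϰ : ℝ} (hϰ : 0 < ϰ) {p₀ σ' c κ' : ℝ} (hp₀ : 2 / 3 < p₀) (hσ : 0 < σ') (hc : 0 ≤ c) (hκ : 0 < κ') (hκσ : κ' < σ' * (t + 1)) :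
    ∃ M₄ δ a₀ : ℝ, 0 < M₄ ∧ 0 < δ ∧ 0 < a₀ ∧ ∃ b₁ : ℝ, ∀ b₀ : ℝ, b₁ < b₀ → ∃ C : ℝ, 0 ≤ C ∧ ∀ η : ℝ, 0 < η → η ≤ 1 →
      ∀ (x : MemberY θ.d₆ θ.ℓ₆ θ.hd' θ.hL' θ.b₀ θ.b₁ Mstar) [DecidableEq (IBondY x.toKIdx)], M₄ ≤ (geo9Y x).M →
      ∀ α₀ : ℝ, 0 < α₀ → (geo9Y x).M * α₀ ≤ a₀ →
      ∀ (U : CfgY (Matrix (Fin N) (Fin N) ℂ) x.toKIdx),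
        (bg9YP (Matrix (Fin N) (Fin N) ℂ) (specialUnitaryUnits (Fin N)) x).Reg335 B9PinGeometryKLevelV1.c35Y α₀ U →
        (bg9YP (Matrix (Fin N) (Fin N) ℂ) (specialUnitaryUnits (Fin N)) x).Reg336 B9PinGeometryKLevelV1.c35Y α₀ U →
        (∀ c' : CBondStY x, ¬ GoodY x c'.1.1 → ∀ i : ℕ, i < θ.ℓ₆ →
          ‖((avYOfRecord x U ⟨ofZ x (labK x c'.1.1 + (i : ℤ) • unitVec c'.1.2), c'.1.2⟩ : (Matrix (Fin N) (Fin N) ℂ)ˣ) :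
              Matrix (Fin N) (Fin N) ℂ) - 1‖ ≤ δV) →
        IsSymmTr (fun _ => (1 : ℝ)) ((𝔯 x).Δ2 U) → IsSymmTr (fun _ => (1 : ℝ)) ((𝔢₀ x).D2J U) →
      ∀ {σ : Type} [Fintype σ] [DecidableEq σ] [Nonempty σ] (ι : σ → IBondY x.toKIdx), Function.Injective ι → (∀ s, lamTstY x (ι s)) →
        (∀ (u v : IBondY x.toKIdx) (E : Matrix (Fin N) (Fin N) ℂ), inΛstY x u → inΛstY x v →
          ‖((((etaDY x : ℝ) : ℂ) • (aY x.toKIdx + (𝔢₀ x).D2J U)).restrictScalars ℝ) (Pi.single v E) u‖ ≤ KJ * ‖E‖ * Real.exp (-(δ * unitDistY x u v))) →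
        (∀ B : IBondY x.toKIdx → Matrix (Fin N) (Fin N) ℂ, (∀ q, ¬ inΛstY x q → B q = 0) → (∀ q, IsAxialY x q → B q = 0) →
          (∀ c' : CBondStY x, Q1Y x (avYOfRecord x) U c'.1 B = 0) →
          γ₀ * trIP (fun _ => (1 : ℝ)) B B ≤
            trIP (fun _ => (1 : ℝ)) B (deltaKPstY x (lettersYOfRecordV4P N θ Mstar 𝔯 x) (sectEStYOfRecordV7 N θ Mstar 𝔢₀ x) U B)) →
      ∃ (Λ : Finset (B1Eq324BenfattoLemma.Site (θ.d₆ + 1 + (θ.d₆ + 1) + 1))) (e' : σ × TrIdx N ≃ ↥Λ),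
        ((gaussianFieldOfKernel fun u w => if h : u ∈ Λ ∧ w ∈ Λ then
            ((Matrix.reindex e' e'
              (Matrix.of fun p q : σ × TrIdx N =>
                  trReForm (trBasis N p.2) (((CsDeltaCPstY x (lettersYOfRecordV4P N θ Mstar 𝔯 x)
            (sectEStYOfRecordV7 N θ Mstar 𝔢₀ x) U).restrictScalars ℝ)
                    (Pi.single (ι q.1) (trBasis N q.2)) (ι p.1))))⁻¹ :
                Matrix ↥Λ ↥Λ ℝ) ⟨u, h.1⟩ ⟨w, h.2⟩ else 0).map
            (fun (z : B1Eq324BenfattoLemma.Site (θ.d₆ + 1 + (θ.d₆ + 1) + 1) → ℝ) (q : σ × TrIdx N) => z ((e' q : ↥Λ) : B1Eq324BenfattoLemma.Site (θ.d₆ + 1 + (θ.d₆ + 1) + 1))) =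
          gaussianFieldOfKernel fun p q =>
            ((Matrix.of fun p q : σ × TrIdx N =>
                trReForm (trBasis N p.2) (((CsDeltaCPstY x (lettersYOfRecordV4P N θ Mstar 𝔯 x)
            (sectEStYOfRecordV7 N θ Mstar 𝔢₀ x) U).restrictScalars ℝ)
                  (Pi.single (ι q.1) (trBasis N q.2)) (ι p.1)))⁻¹ :
              Matrix (σ × TrIdx N) (σ × TrIdx N) ℝ) p q) ∧
        (∀ p : ℝ, 0 ≤ p →
          ((fun (z : B1Eq324BenfattoLemma.Site (θ.d₆ + 1 + (θ.d₆ + 1) + 1) → ℝ) (q : σ × TrIdx N) => z ((e' q : ↥Λ) : B1Eq324BenfattoLemma.Site (θ.d₆ + 1 + (θ.d₆ + 1) + 1))) ⁻¹'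
              {ω : σ × TrIdx N → ℝ | ∀ q, |ω q| ≤ p}) =ᵐ[gaussianFieldOfKernel fun u w => if h : u ∈ Λ ∧ w ∈ Λ then
                ((Matrix.reindex e' e'
                  (Matrix.of fun p q : σ × TrIdx N =>
                      trReForm (trBasis N p.2) (((CsDeltaCPstY x (lettersYOfRecordV4P N θ Mstar 𝔯 x)
            (sectEStYOfRecordV7 N θ Mstar 𝔢₀ x) U).restrictScalars ℝ)
                        (Pi.single (ι q.1) (trBasis N q.2)) (ι p.1))))⁻¹ :
                    Matrix ↥Λ ↥Λ ℝ) ⟨u, h.1⟩ ⟨w, h.2⟩ else 0]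
            smallFieldSet Λ p) ∧
        ∀ (s : ℕ) (I J : Finset (B1Eq324BenfattoLemma.Site (θ.d₆ + 1 + (θ.d₆ + 1) + 1))) (𝔞 : Coef (θ.d₆ + 1 + (θ.d₆ + 1) + 1)),
          I.Nonempty → J ⊆ I → J ⊆ Λ → coefSup s D 𝔞 J ≤ c * η ^ σ' →
          0 < ∫ z, cutoffBoltzmann (hamiltonian s D ϰ 𝔞 J) I (B10.pFun b₀ p₀ η) z ∂(gaussianFieldOfKernel fun u w => if h : u ∈ Λ ∧ w ∈ Λ then
              ((Matrix.reindex e' e'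
                (Matrix.of fun p q : σ × TrIdx N =>
                    trReForm (trBasis N p.2) (((CsDeltaCPstY x (lettersYOfRecordV4P N θ Mstar 𝔯 x)
            (sectEStYOfRecordV7 N θ Mstar 𝔢₀ x) U).restrictScalars ℝ)
                      (Pi.single (ι q.1) (trBasis N q.2)) (ι p.1))))⁻¹ :
                  Matrix ↥Λ ↥Λ ℝ) ⟨u, h.1⟩ ⟨w, h.2⟩ else 0) ∧
            |Real.log (∫ z, cutoffBoltzmann (hamiltonian s D ϰ 𝔞 J) I (B10.pFun b₀ p₀ η) z ∂(gaussianFieldOfKernel fun u w =>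
                if h : u ∈ Λ ∧ w ∈ Λ then
                  ((Matrix.reindex e' e'
                    (Matrix.of fun p q : σ × TrIdx N =>
                        trReForm (trBasis N p.2) (((CsDeltaCPstY x (lettersYOfRecordV4P N θ Mstar 𝔯 x)
            (sectEStYOfRecordV7 N θ Mstar 𝔢₀ x) U).restrictScalars ℝ)
                          (Pi.single (ι q.1) (trBasis N q.2)) (ι p.1))))⁻¹ :
                      Matrix ↥Λ ↥Λ ℝ) ⟨u, h.1⟩ ⟨w, h.2⟩ else 0)) -
              cumulantSum (gaussianFieldOfKernel fun u w => if h : u ∈ Λ ∧ w ∈ Λ then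
                  ((Matrix.reindex e' e'
                    (Matrix.of fun p q : σ × TrIdx N =>
                        trReForm (trBasis N p.2) (((CsDeltaCPstY x (lettersYOfRecordV4P N θ Mstar 𝔯 x)
            (sectEStYOfRecordV7 N θ Mstar 𝔢₀ x) U).restrictScalars ℝ)
                          (Pi.single (ι q.1) (trBasis N q.2)) (ι p.1))))⁻¹ :
                      Matrix ↥Λ ↥Λ ℝ) ⟨u, h.1⟩ ⟨w, h.2⟩ else 0)
                (hamiltonian s D ϰ 𝔞 J) t| ≤ C * η ^ κ' * I.card :=
  eq324_CsDeltaCPstY_lettersYOfRecordV4P_sectEStYOfRecordV7_trBasis_of_stmt3132Printed_P_of_pivotLines_onΛst_on_unit N θ Mstar 𝔯 𝔢₀ 𝔢st 𝔴 𝔈 h06.s3132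
    hγ₀ hKJ hδV hsmall t D hϰ hp₀ hσ hc hκ hκσ

end Doors

end Literature.MathematicalPhysics.QuantumFieldTheory.Balaban1983to89.B1Eq324BenfattoClassSectEMemberPrecisionDoorRecordV4PPivotLines

end
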